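import Mathlib
import Summits.Ventures.PercRepro2.K5HyperK3Cmp

/-!
# THE `M-TRI` CERTIFICATES OF THE CRUX KERNEL, PART 6
(blind cell PercRepro2, typer-1 g10; mine-1 §23.12; twin `k5hyper_k3cmp_typer.py`)

`CertLE (kNegM3 (triMask T) (pairMask e)) (kPosM3 …)`: `N(K₅ + T(1) + e(1)) ≥ N(K₅ + T(1))` for the (TRI) kernel `K₃` at every `K₅` profile (`240` products of three Kronecker numbers).  Each certificate is one `decide +kernel` under `maxHeartbeats 0` (the kernel's deterministic timeout,
not memory, was the wall of the `K₅` certificates: `set_option maxHeartbeats 0` is the rule of record for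
them).
-/

namespace Summit.Ventures.PercRepro2

namespace K5

set_option maxRecDepth 100000 in
set_option maxHeartbeats 0 in
/-- `M-TRI ≥ 0` on the triangle `T = {1, 3, 4}`, pair `e = {1, 4}`. -/
theorem cert_M3_134_14 :
    CertLE (kNegM3 (triMask 1 3 4) (pairMask 1 4)) (kPosM3 (triMask 1 3 4) (pairMask 1 4)) := by
  unfold CertLE
  decide +kernel

set_option maxRecDepth 100000 in
set_option maxHeartbeats 0 in
/-- `M-TRI ≥ 0` on the triangle `T = {1, 3, 4}`, pair `e = {3, 4}`. -/
theorem cert_M3_134_34 :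
    CertLE (kNegM3 (triMask 1 3 4) (pairMask 3 4)) (kPosM3 (triMask 1 3 4) (pairMask 3 4)) := by
  unfold CertLE
  decide +kernel

set_option maxRecDepth 100000 in
set_option maxHeartbeats 0 in
/-- `M-TRI ≥ 0` on the triangle `T = {2, 3, 4}`, pair `e = {2, 3}`. -/
theorem cert_M3_234_23 :
    CertLE (kNegM3 (triMask 2 3 4) (pairMask 2 3)) (kPosM3 (triMask 2 3 4) (pairMask 2 3)) := by
  unfold CertLE
  decide +kernel

set_option maxRecDepth 100000 in
set_option maxHeartbeats 0 in
/-- `M-TRI ≥ 0` on the triangle `T = {2, 3, 4}`, pair `e = {2, 4}`. -/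
theorem cert_M3_234_24 :
    CertLE (kNegM3 (triMask 2 3 4) (pairMask 2 4)) (kPosM3 (triMask 2 3 4) (pairMask 2 4)) := by
  unfold CertLE
  decide +kernel

set_option maxRecDepth 100000 in
set_option maxHeartbeats 0 in
/-- `M-TRI ≥ 0` on the triangle `T = {2, 3, 4}`, pair `e = {3, 4}`. -/
theorem cert_M3_234_34 :
    CertLE (kNegM3 (triMask 2 3 4) (pairMask 3 4)) (kPosM3 (triMask 2 3 4) (pairMask 3 4)) := by
  unfold CertLE
  decide +kernel

end K5

end Summit.Ventures.PercRepro2
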